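import Literature.NumberTheory.Automorphic.Liu2021.NablaOfPieces
import HarnessLib

/-!
# Liu 2021 §2.1: uniqueness of the Albanese datum WITH its compatibilities (the isomorphism of two data commutes with
# the two Albanese morphisms and with the two carriers `∇X ↪ X × X`)

Topic `Literature/NumberTheory/Automorphic/Liu2021`; namespace `Literature.NumberTheory.Automorphic.Liu2021.AppendixC`.  PROOF FILE
(one theorem, no definition, no named fact, no `sorry`).  Sequel of `NablaOfPieces.lean` (`Nabla.exists_iso`, `Albanese.nonempty_iso`:
two Albanese data of the same `X` — Def. 2.3, typed `AppendixC.Albanese X` in `AppendixC/Glue.lean` — have isomorphic Albanese varieties).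
That file keeps only `Nonempty (a₁.Alb ≅ a₂.Alb)`; the consumers of the α-COMPATIBLE finite-Galois Albanese fan (cell hodgecm-mathlib,
III-0 «(G)-road», piece G3; lead A-p18, director g2 BATCH 59) need the isomorphism TOGETHER WITH its two commutation laws, which the
proof of `Albanese.nonempty_iso` already establishes: the isomorphism IS `a₁.desc (e ≫ α₂)` for the carrier isomorphism
`e : ∇₁X ≅ ∇₂X` of `Nabla.exists_iso`, so `α₁ ≫ φ = e ≫ α₂` is `a₁.fac`.  HC_CM is proved only modulo the 7 printed citations until rung 0
closes; this file discharges nothing by itself.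

## References
* [Liu2021] Y. Liu, *Fourier–Jacobi cycles and arithmetic relative trace formula*, Camb. J. Math. 9 (2021) = arXiv:2102.11518: §2.1
  Def. 2.1 (1) (FJcycle.tex l. 1171–1174), Proposition (l. 1190–1192), Def. 2.3 (l. 1202–1208).
-/

noncomputable section

open CategoryTheory CategoryTheory.Limits AlgebraicGeometry MonoidalCategory CartesianMonoidalCategory
open Literature.AlgebraicGeometry.Motives
open scoped MonObj

universe u

namespace Literature.NumberTheory.Automorphic.Liu2021.AppendixC

variable {L : Type u} [Field L] {X : SchemeOver L}

/-- **Uniqueness of the Albanese datum with its compatibilities** ([Liu2021] §2.1, «the abelian variety that corepresents the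
functor», l. 1203): for two Albanese data `a₁ a₂ : Albanese X` there are an isomorphism of carriers `e : ∇₁X ≅ ∇₂X` OVER `X × X`
(`e ≫ incl₂ = incl₁`, hence `Δ₁ ≫ e = Δ₂`) and an isomorphism of abelian varieties `φ : Alb₁ ≅ Alb₂` with `α₁ ≫ φ = e ≫ α₂`
(`φ := a₁.desc (e ≫ α₂)`, its inverse `a₂.desc (e⁻¹ ≫ α₁)`; the law is `a₁.fac`).  Ours.
[cite: Liu2021, §2.1 Proposition (l. 1190–1192) and Def. 2.3 (l. 1202–1208); Def. 2.1 (1) (l. 1171–1174)] -/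
theorem Albanese.exists_iso_compat (a₁ a₂ : Albanese X) :
    ∃ (e : a₁.nabla.N ≅ a₂.nabla.N) (φ : a₁.Alb ≅ a₂.Alb),
      e.hom ≫ a₂.nabla.incl = a₁.nabla.incl ∧ a₁.nabla.diag ≫ e.hom = a₂.nabla.diag ∧
        a₁.α ≫ φ.hom.hom.hom.hom = e.hom ≫ a₂.α := by
  obtain ⟨e, he⟩ := Nabla.exists_iso a₁.nabla a₂.nabla
  have hdiag : a₁.nabla.diag ≫ e.hom = a₂.nabla.diag := by
    haveI := a₂.nabla.isOpenImmersion_incl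
    haveI : Mono a₂.nabla.incl := Over.mono_of_mono_left _
    rw [← cancel_mono a₂.nabla.incl, Category.assoc, he, a₁.nabla.diag_incl, a₂.nabla.diag_incl]
  have hdiag' : a₂.nabla.diag ≫ e.inv = a₁.nabla.diag := by
    rw [← hdiag, Category.assoc, e.hom_inv_id, Category.comp_id]
  have h₁ : a₁.nabla.diag ≫ e.hom ≫ a₂.α = 1 := by rw [← Category.assoc, hdiag, a₂.diag_α]
  have h₂ : a₂.nabla.diag ≫ e.inv ≫ a₁.α = 1 := by rw [← Category.assoc, hdiag', a₁.diag_α]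
  refine ⟨e, ⟨a₁.desc (e.hom ≫ a₂.α) h₁, a₂.desc (e.inv ≫ a₁.α) h₂, ?_, ?_⟩, he, hdiag, a₁.fac _ h₁⟩
  · apply a₁.hom_ext
    change a₁.α ≫ (a₁.desc _ h₁).hom.hom.hom ≫ (a₂.desc _ h₂).hom.hom.hom = a₁.α ≫ 𝟙 _
    rw [← Category.assoc, a₁.fac, Category.assoc, a₂.fac, e.hom_inv_id_assoc, Category.comp_id]
  · apply a₂.hom_ext
    change a₂.α ≫ (a₂.desc _ h₂).hom.hom.hom ≫ (a₁.desc _ h₁).hom.hom.hom = a₂.α ≫ 𝟙 _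
    rw [← Category.assoc, a₂.fac, Category.assoc, a₁.fac, e.inv_hom_id_assoc, Category.comp_id]

end Literature.NumberTheory.Automorphic.Liu2021.AppendixC

end
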